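import Summits.QuantumFields.BalabanUV.Beta.CombMixedT2EvenStoreyPeriodised
import Summits.QuantumFields.BalabanUV.Beta.CombMixedT2EvenStoreyTwoTorus

/-!
# `BalabanUV.Beta.CombMixedT2EvenStoreyTorus` — binder row D1 ∕ (C1), PART 33b: **(K2b) ON THE TORUS AT EVERY DEPTH, STOREYWISE — THE RECURSION**: for the
# coarse-slot-periodised even COMPOSITE mixed table of depth `m+1` (any box `M = Lc^{m+1}·M′`, PART 33a's family `V`) and every indicator gauge `δ_s`,
# `Σ_{u ∈ pbox M} Σ_κ tgrad M (u, inl κ) s · perZ M (dper M (V κ u)) x z (inl α) (inl γ)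
#   = wM2 · Σ_{b₁,b₂ ∈ win β} (δ_s(R_m b₂) − δ_s(R_m b₁))·h(β;b₁,b₂)·cL̃_m((α,x);b₁)·cL̃_m((γ,z);b₂) + Σ_{b ∈ win β} ℓ(β;b)·[the same row of the periodised depth-m table at b]`,
# `cL̃_m((α,x);b) := Σ'_n compLin_m((α, x + M∘n); b)` (the fine-slot-periodised `m`-fold transport), `R_m v = Lc^m•v + Σ_{k<m} Lc^k•ρ_c` (finest root of the level-`m` block),
# the depth-`m` family at the window bond `b = (κ, Lc•w+e)` periodised over the level-`m` period lattice `Lc·M′` — PART 32's lattice recursion carried to the torus by PART 31's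
# engine (31b §4∕§6 BY NAME), at every depth; at `m = 1` the lower rows are PART 26's pure commutators and the display is PART 31c's

WHY (J-NOTE-14 §5; road FP A-3 → v7 at every box).  New letters (§4): under a coarse-period shift `w ↦ w + M′∘n` of the multiplier bond the `m`-fold transports to the window bonds
shift their fine slot by `−M∘n` (F6a `compLinKer_sh`), the level-`m` roots shift by `M∘n`, the top bricks are unchanged (31b §5), and the lattice row of the depth-`m` table at a
window bond of the copy along a PERIODIC gauge function is the row at the original window bond read at the fluctuation pair shifted by `−M∘n` (33a's `compMixedT2_even_translate`
+ re-indexing of the fine bond); so (§5) the row of the depth-(m+1) family is `Σ'_k Σ'_n` of ONE lattice word = top word + `Σ_b ℓ(β;b) ·` lower rows, the lower families' rows are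
`Σ'_k Σ'_n` of the lower lattice rows (no site law needed), 31b §6 decouples every piece into finite sums, and the top word folds as a rank-one product of fine-slot-periodised transports.

WHAT (`d = 3`, centred root, weight `wM2 3 L₂ j` free — the tower's is `L₂ = Lc^{n+2}`, `j = 0`; [folklore] `tsum`∕`Finset` re-indexing BY NAME; no `def`, no `def … : Prop`, nothing
cited, 0 sorry): §4 `translate_neg_add_pow_smul_smul`, **`compLinKer_copy`**, **`rootR_copy`**, **`tsum_sum_dz_mul_compMixedT2_even_low_copy`**; §5 `translate_mulPeriod_smul_add`
(`(Lc•w+e) + (Lc·M′)∘n = Lc•(w+M′∘n) + e`), **`tsum_sum_dz_tdelta_mul_compMixedT2per_even_succ`** (steps B–D), **`tsum_sum_dz_tdelta_mul_compMixedT2per_even_low`** (steps B+D for the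
lower families), **`tsum_tsum_storeyWords_succ_eq`** (step F, generic lower kernels), **`sum_tgrad_mul_perZ_dper_compMixedT2per_even_succ`** (the display above; the lower families
hypothesis-bound: `hVl κ e : Vl κ e = fun κ′ u x z a c => Σ'_n M2ᵉ_m κ′ u κ ((Lc•w+e) + (Lc·M′)∘n) x z a c`).
WHAT THIS IS NOT: not the matrix∕gauge-function packaging at depth `m+1` (one `ext` + `sum_tdelta_mul`, as PART 31d — on the road's word); not an unrolled closed form over all
storeys; not (J-R₂) nor v7's display; nothing of Bałaban's asserted, valued or discharged; 0 estimates; 0∕4 row-D1 binders (hW, hR, D1Tel, D1Rep); ROOT M‴ p325680 ∕ P5c ∕ D6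
untouched; NOT (C1), NOT (T-ID), NOT D1, NEVER «G-an2-4 closed», NOT BetaPertH, NOT continuum, NOT Clay.

HONEST DEPENDENCY (page 1, mandatory): continuum YM on T⁴ ⇐ BetaPertH ∧ nine spine estimates (0/9 proved); BetaPertH ⇐ (D1) ∧ (D4) ∧ CAP+tail;
G-an2-4 gates asym, D1 and NE2/3/4.  HONEST FRAMING (cell contract, verbatim): «discharging `BetaPertH` makes Bałaban's UV stability UNCONDITIONAL —
a real constructive-QFT result; it is NOT the continuum limit and NOT the Clay problem.»  ABSOLUTE RULE (cell charter, verbatim): «No internally-minted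
statement may enter as a cited fact. Every hypothesis is either kernel-proved in this package or a verbatim quotation of a PUBLISHED theorem with page
reference. The manuscript(s) under audit are NOT citable for their own disputed steps — they are the thing under adjudication; programme-internal
(2001/route/tribunal) claims are never citable.»  Row D1 ∕ (C1) OWNER an2 (b2b-balaban-beta-an2) gen 71, 2026-08-28.  §5 shaped on PART 31c (same proof, `ℓ ↦ compLin_m`,
lower bricks ↦ lower rows).  No existing file touched.
-/

noncomputable section

open scoped BigOperators

namespace Summit.QuantumFields.BalabanUV.Beta.CombMixedT2EvenStoreyTorus

open Finset Matrix
open Literature.MathematicalPhysics.QuantumFieldTheory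
open Literature.MathematicalPhysics.QuantumFieldTheory.Balaban1983to89
open Literature.MathematicalPhysics.QuantumFieldTheory.Balaban1983to89.Beta
open B4TorusKernel.MultiPeriod (translate translate_apply)
open B4Reflection242 (translate_translate)
open B6Lemma24Torus (pbox mem_pbox)
open ExpKernelCalculus (MKer shiftK)
open AffineAveraging (Site box toSite unitVec dz)
open AveragingContoursRooted (ctr ctrOff ctrOff_mem_box)
open AveragingHessianKernels (Bond Near)
open OneStepResolventKernel (Fib)
open BalabanStepW2 (M2Of wM2)
open Summit.QuantumFields.BalabanUV.Beta.TameKernelCalculus (trK)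
open Summit.QuantumFields.BalabanUV.Beta.BorderedHessian (sgnK)
open Summit.QuantumFields.BalabanUV.Beta.AxialDressingRooted (one_le_of_neZero)
open Summit.QuantumFields.BalabanUV.Beta.SymAveragingHessianCounts (symLinKerAt symHessKerAt symLinKerAt_add symHessKerAt_add)
open Summit.QuantumFields.BalabanUV.Beta.CompositeVertexKernelRec (offs winF wid compLinKer compLinKer_eq_zero compLinKer_sh mem_winF_succ_of_offs)
open Summit.QuantumFields.BalabanUV.Beta.CompositeVertexKernelLiftKernel (mem_piFinset_of_mem_winF)
open Summit.QuantumFields.BalabanUV.Beta.CompositeOneShotJets (compMix)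
open Summit.QuantumFields.BalabanUV.Beta.FP.KernelPeriodisationFib (Idx perF perF_apply perZ perZ_apply translate_eq_add)
open Summit.QuantumFields.BalabanUV.Beta.FP.KernelPeriodisationFibLoc (dper dper_apply)
open Summit.QuantumFields.BalabanUV.Beta.FP.TorusGaugeCovariance (tdelta tdelta_translate tgrad)
open Summit.QuantumFields.BalabanUV.Beta.FP.PeriodisedBorderIndexWard (translate_injective)
open Summit.QuantumFields.BalabanUV.Beta.FP.PeriodisedBorderTables (translate_eq_add_smul)
open Summit.QuantumFields.BalabanUV.Beta.CombMixedT2EvenStoreyPeriodised (compMixedT2_even_translate compMixedT2_even_inl_inl_eq_zero_of_left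
  compMixedT2_even_inl_inl_eq_zero_of_right compMixedT2per_even_periodCov compMixedT2per_even_inl_inl_eq_zero_of_not_mem_T compMixedT2per_even_inl_inl_eq_zero_of_not_mem_S
  tsum_sum_dz_mul_compMixedT2per_even_inl_inl tsum_sum_dz_mul_compMixedT2_even_succ_inl_inl)
open Summit.QuantumFields.BalabanUV.Beta.CombMixedT2EvenStoreyTwoCopies (sum_tgrad_mul_perZ_dper_eq_tsum_of_periodCov smul_translate_add symHessKerAt_top_copy
  symLinKerAt_top_copy tsum_tsum_translate_eq_sum_sum)
open Summit.QuantumFields.BalabanUV.Beta.CombMixedT2EvenStoreyTwoTorus (sum_push4 sum_push2)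

variable {Lc : ℕ} [NeZero Lc]

/-! ## §4 Copies of the coarse bond at depth `m+1` (`M = Lc^{m+1}·M′`): the `m`-fold transports, the roots, and the lower row are jointly period-covariant -/

section Copies

variable {M M' : Fin (3 + 1) → ℕ} (L₂ j m : ℕ) (w n : Site (3 + 1))

omit [NeZero Lc] in
/-- [folklore] a fine site shifted back by a period vector of `M = Lc^{m+1}·M′` and forward by `Lc^m•Lc•(M′∘n)` is itself. -/
theorem translate_neg_add_pow_smul_smul (hM : ∀ i, M i = Lc ^ (m + 1) * M' i) (x : Site (3 + 1)) :
    translate M x (-n) + ((Lc ^ m : ℕ) : ℤ) • ((Lc : ℤ) • fun i => (M' i : ℤ) * n i) = x := by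
  rw [translate_eq_add_smul hM]
  funext i
  simp only [Pi.add_apply, Pi.smul_apply, Pi.neg_apply, smul_eq_mul]
  push_cast
  ring

omit [NeZero Lc] in
/-- [folklore] (TOP STOREY, transports) the `m`-fold composite transport to a level-`m` bond of the COPY, read at a fine bond, is the transport to the original bond read at the fine
bond shifted back by the period vector (F6a `compLinKer_sh`): `compLin_m((ξ,x); (κ₁, Lc•(w+M′∘n)+e₁)) = compLin_m((ξ, x − M∘n); (κ₁, Lc•w+e₁))`. -/
theorem compLinKer_copy (hM : ∀ i, M i = Lc ^ (m + 1) * M' i) (κ₁ : Fin (3 + 1)) (e₁ : Site (3 + 1)) (ξ : Fin (3 + 1)) (x : Site (3 + 1)) :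
    compLinKer (fun _ => symLinKerAt (ctr 4 Lc) Lc) Lc m (ξ, x) (κ₁, (Lc : ℤ) • translate M' w n + e₁)
      = compLinKer (fun _ => symLinKerAt (ctr 4 Lc) Lc) Lc m (ξ, translate M x (-n)) (κ₁, (Lc : ℤ) • w + e₁) := by
  have h := compLinKer_sh (ℓ := fun _ => symLinKerAt (ctr 4 Lc) Lc) (L := Lc) (fun _ μ y t f => symLinKerAt_add (ctr 4 Lc) Lc μ y t f) m
    (ξ, translate M x (-n)) (κ₁, (Lc : ℤ) • w + e₁) ((Lc : ℤ) • fun i => (M' i : ℤ) * n i)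
  rw [← h, smul_translate_add]
  congr 1
  refine Prod.ext rfl ?_
  show x = translate M x (-n) + (Lc : ℤ) ^ m • ((Lc : ℤ) • fun i => (M' i : ℤ) * n i)
  rw [show (Lc : ℤ) ^ m = ((Lc ^ m : ℕ) : ℤ) by rw [Nat.cast_pow], translate_neg_add_pow_smul_smul m n hM x]

omit [NeZero Lc] in
/-- [folklore] (TOP STOREY, roots) the finest root of a level-`m` block of the COPY is the period translate of the original's: `R_m(Lc•(w+M′∘n)+e) = R_m(Lc•w+e) + M∘n`. -/
theorem rootR_copy (hM : ∀ i, M i = Lc ^ (m + 1) * M' i) (e : Site (3 + 1)) :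
    ((Lc ^ m : ℕ) : ℤ) • ((Lc : ℤ) • translate M' w n + e) + ∑ k ∈ Finset.range m, ((Lc ^ k : ℕ) : ℤ) • ctr 4 Lc
      = translate M (((Lc ^ m : ℕ) : ℤ) • ((Lc : ℤ) • w + e) + ∑ k ∈ Finset.range m, ((Lc ^ k : ℕ) : ℤ) • ctr 4 Lc) n := by
  rw [translate_eq_add_smul hM, translate_eq_add]
  funext i
  simp only [Pi.add_apply, Pi.smul_apply, smul_eq_mul]
  push_cast
  ring

omit [NeZero Lc] in
/-- [folklore] (LOWER STOREY, the depth-`m` row) **the lattice contraction of the depth-`m` even table at a window bond of the COPY with a PERIODIC gauge function equals the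
contraction at the original window bond read at the fluctuation pair shifted back by the period vector** (33a's joint block covariance at depth `m` with `Lc^m•Lc•(M′∘n) = M∘n`,
re-indexing the fine bond by the period vector, periodicity of the gauge function). -/
theorem tsum_sum_dz_mul_compMixedT2_even_low_copy (hM : ∀ i, M i = Lc ^ (m + 1) * M' i) (lam : Site (3 + 1) → ℝ) (hlam : ∀ x k, lam (translate M x k) = lam x)
    (κ : Fin (3 + 1)) (e x z : Site (3 + 1)) (α γ : Fin (3 + 1)) :
    (∑' u : Site (3 + 1), ∑ κ' : Fin (3 + 1), dz lam κ' u *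
        ((1 / 2 : ℝ) • (M2Of 3 L₂ (compMix (ctrOff (3 + 1) Lc) Lc m) j κ' u κ ((Lc : ℤ) • translate M' w n + e)
          + sgnK (trK (M2Of 3 L₂ (compMix (ctrOff (3 + 1) Lc) Lc m) j κ' u κ ((Lc : ℤ) • translate M' w n + e))))) x z (Sum.inl α) (Sum.inl γ))
      = ∑' u : Site (3 + 1), ∑ κ' : Fin (3 + 1), dz lam κ' u *
        ((1 / 2 : ℝ) • (M2Of 3 L₂ (compMix (ctrOff (3 + 1) Lc) Lc m) j κ' u κ ((Lc : ℤ) • w + e)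
          + sgnK (trK (M2Of 3 L₂ (compMix (ctrOff (3 + 1) Lc) Lc m) j κ' u κ ((Lc : ℤ) • w + e))))) (translate M x (-n)) (translate M z (-n)) (Sum.inl α) (Sum.inl γ) := by
  -- per fine bond: the table at the copy is the table at the original with every fine argument shifted back by `M∘n`
  have hper : ∀ (κ' : Fin (3 + 1)) (u : Site (3 + 1)),
      ((1 / 2 : ℝ) • (M2Of 3 L₂ (compMix (ctrOff (3 + 1) Lc) Lc m) j κ' u κ ((Lc : ℤ) • translate M' w n + e)
          + sgnK (trK (M2Of 3 L₂ (compMix (ctrOff (3 + 1) Lc) Lc m) j κ' u κ ((Lc : ℤ) • translate M' w n + e))))) x z (Sum.inl α) (Sum.inl γ)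
        = ((1 / 2 : ℝ) • (M2Of 3 L₂ (compMix (ctrOff (3 + 1) Lc) Lc m) j κ' (translate M u (-n)) κ ((Lc : ℤ) • w + e)
          + sgnK (trK (M2Of 3 L₂ (compMix (ctrOff (3 + 1) Lc) Lc m) j κ' (translate M u (-n)) κ ((Lc : ℤ) • w + e)))))
          (translate M x (-n)) (translate M z (-n)) (Sum.inl α) (Sum.inl γ) := fun κ' u => by
    have h := compMixedT2_even_translate (Lc := Lc) L₂ j m κ' (translate M u (-n)) κ ((Lc : ℤ) • w + e) ((Lc : ℤ) • fun i => (M' i : ℤ) * n i)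
      (translate M x (-n)) (translate M z (-n)) (Sum.inl α) (Sum.inl γ)
    rw [translate_neg_add_pow_smul_smul m n hM u, translate_neg_add_pow_smul_smul m n hM x, translate_neg_add_pow_smul_smul m n hM z, ← smul_translate_add] at h
    exact h
  simp only [hper]
  -- re-index the fine bond by the period vector; the gauge function is periodic
  refine Eq.trans ((Equiv.addRight (fun i => (M i : ℤ) * n i)).tsum_eq _).symm (tsum_congr fun u => ?_)
  have e0 : translate M (u + fun i => (M i : ℤ) * n i) (-n) = u := by
    funext i
    simp only [translate_apply, Pi.add_apply, Pi.neg_apply]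
    ring
  have e1 : ∀ v : Site (3 + 1), v + (fun i => (M i : ℤ) * n i) = translate M v n := fun v => by rw [translate_eq_add]
  simp only [Equiv.coe_addRight, e0]
  refine Finset.sum_congr rfl fun κ' _ => ?_
  simp only [dz]
  rw [add_right_comm, e1, e1, hlam, hlam]

end Copies

/-! ## §5 (K2b) on the torus at depth `m+1`, storeywise: the row of the periodised even composite table is the top storey's word plus the top linear brick times the rows of
the periodised depth-`m` tables at the window bonds -/

section Torus

variable {M M' : Fin (3 + 1) → ℕ} [∀ μ, NeZero (M μ)] [∀ μ, NeZero (M' μ)] (L₂ j m : ℕ) (ρ' : Fin (3 + 1)) (w : Site (3 + 1))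
  {V : Fin (3 + 1) → Site (3 + 1) → MKer (3 + 1) (Fib 3)} {Vl : Fin (3 + 1) → Site (3 + 1) → Fin (3 + 1) → Site (3 + 1) → MKer (3 + 1) (Fib 3)}

omit [NeZero Lc] [∀ μ, NeZero (M μ)] [∀ μ, NeZero (M' μ)] in
/-- [folklore] the copies of a level-`m` window bond under the level-`m` period lattice `Lc·M′` are the window bonds of the copies of the coarse bond:
`(Lc•w + e) + (Lc·M′)∘n = Lc•(w + M′∘n) + e`. -/
theorem translate_mulPeriod_smul_add (e n : Site (3 + 1)) :
    translate (fun i => Lc * M' i) ((Lc : ℤ) • w + e) n = (Lc : ℤ) • translate M' w n + e := by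
  rw [smul_translate_add, translate_eq_add]
  funext i
  simp only [Pi.add_apply, Pi.smul_apply, smul_eq_mul]
  push_cast
  ring

omit [∀ μ, NeZero (M μ)] in
/-- [folklore] **STEPS B–D AT DEPTH `m+1`**: the lattice contraction of the periodised family with the periodic indicator is the sum over period shifts of the original bond's top-storey
word (`wM2 ·`) plus the top linear brick times the lattice rows of the depth-`m` tables at the ORIGINAL window bonds, read at the shifted fluctuation pair. -/
theorem tsum_sum_dz_tdelta_mul_compMixedT2per_even_succ (hM : ∀ i, M i = Lc ^ (m + 1) * M' i)
    (hV : V = fun κ u x z a c => ∑' n : Site (3 + 1),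
      ((1 / 2 : ℝ) • (M2Of 3 L₂ (compMix (ctrOff (3 + 1) Lc) Lc (m + 1)) j κ u ρ' (translate M' w n)
          + sgnK (trK (M2Of 3 L₂ (compMix (ctrOff (3 + 1) Lc) Lc (m + 1)) j κ u ρ' (translate M' w n))))) x z a c)
    (s : ↥(pbox M)) (x z' : Site (3 + 1)) (α γ : Fin (3 + 1)) :
    (∑' u : Site (3 + 1), ∑ κ : Fin (3 + 1), dz (fun w => tdelta M w s) κ u * V κ u x z' (Sum.inl α) (Sum.inl γ))
      = ∑' n : Site (3 + 1), (wM2 3 L₂ j * (∑ κ₁ : Fin (3 + 1), ∑ e₁ ∈ offs Lc, ∑ κ₂ : Fin (3 + 1), ∑ e₂ ∈ offs Lc,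
          (tdelta M (((Lc ^ m : ℕ) : ℤ) • ((Lc : ℤ) • w + e₂) + ∑ k ∈ Finset.range m, ((Lc ^ k : ℕ) : ℤ) • ctr 4 Lc) s
              - tdelta M (((Lc ^ m : ℕ) : ℤ) • ((Lc : ℤ) • w + e₁) + ∑ k ∈ Finset.range m, ((Lc ^ k : ℕ) : ℤ) • ctr 4 Lc) s)
            * symHessKerAt (ctr 4 Lc) Lc ρ' w (κ₁, (Lc : ℤ) • w + e₁) (κ₂, (Lc : ℤ) • w + e₂)
            * compLinKer (fun _ => symLinKerAt (ctr 4 Lc) Lc) Lc m (α, translate M x n) (κ₁, (Lc : ℤ) • w + e₁)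
            * compLinKer (fun _ => symLinKerAt (ctr 4 Lc) Lc) Lc m (γ, translate M z' n) (κ₂, (Lc : ℤ) • w + e₂))
        + ∑ κ : Fin (3 + 1), ∑ e ∈ offs Lc, symLinKerAt (ctr 4 Lc) Lc ρ' w (κ, (Lc : ℤ) • w + e)
            * ∑' u : Site (3 + 1), ∑ κ' : Fin (3 + 1), dz (fun w => tdelta M w s) κ' u *
                ((1 / 2 : ℝ) • (M2Of 3 L₂ (compMix (ctrOff (3 + 1) Lc) Lc m) j κ' u κ ((Lc : ℤ) • w + e)
                  + sgnK (trK (M2Of 3 L₂ (compMix (ctrOff (3 + 1) Lc) Lc m) j κ' u κ ((Lc : ℤ) • w + e)))))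
                  (translate M x n) (translate M z' n) (Sum.inl α) (Sum.inl γ)) := by
  rw [tsum_sum_dz_mul_compMixedT2per_even_inl_inl L₂ j (m + 1) ρ' w hV,
    tsum_congr fun n => tsum_sum_dz_mul_compMixedT2_even_succ_inl_inl (Lc := Lc) L₂ j m (fun w => tdelta M w s) ρ' (translate M' w n) x z' α γ]
  -- copy `n` ↔ fluctuation pair shifted by `−M∘n`; reverse the copy index
  refine Eq.trans (tsum_congr fun n => ?_) ((Equiv.neg (Site (3 + 1))).tsum_eq _)
  simp only [Equiv.neg_apply, compLinKer_copy m w n hM, symHessKerAt_top_copy, symLinKerAt_top_copy, rootR_copy m w n hM, tdelta_translate,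
    tsum_sum_dz_mul_compMixedT2_even_low_copy L₂ j m w n hM (fun w => tdelta M w s) (fun v k => tdelta_translate M v k s)]

omit [∀ μ, NeZero (M μ)] in
/-- [folklore] **STEPS B+D FOR THE LOWER FAMILIES**: the lattice contraction of the periodised depth-`m` table at a window bond (period lattice `Lc·M′` in its coarse slot) with the
periodic indicator is the sum over period shifts of the lattice row of the ORIGINAL table read at the shifted fluctuation pair (no site law used). -/
theorem tsum_sum_dz_tdelta_mul_compMixedT2per_even_low (hM : ∀ i, M i = Lc ^ (m + 1) * M' i) (κ : Fin (3 + 1)) (e : Site (3 + 1))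
    (hVl : Vl κ e = fun κ' u x z a c => ∑' n : Site (3 + 1),
      ((1 / 2 : ℝ) • (M2Of 3 L₂ (compMix (ctrOff (3 + 1) Lc) Lc m) j κ' u κ (translate (fun i => Lc * M' i) ((Lc : ℤ) • w + e) n)
          + sgnK (trK (M2Of 3 L₂ (compMix (ctrOff (3 + 1) Lc) Lc m) j κ' u κ (translate (fun i => Lc * M' i) ((Lc : ℤ) • w + e) n))))) x z a c)
    (s : ↥(pbox M)) (x z' : Site (3 + 1)) (α γ : Fin (3 + 1)) :
    (∑' u : Site (3 + 1), ∑ κ' : Fin (3 + 1), dz (fun w => tdelta M w s) κ' u * Vl κ e κ' u x z' (Sum.inl α) (Sum.inl γ))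
      = ∑' n : Site (3 + 1), ∑' u : Site (3 + 1), ∑ κ' : Fin (3 + 1), dz (fun w => tdelta M w s) κ' u *
          ((1 / 2 : ℝ) • (M2Of 3 L₂ (compMix (ctrOff (3 + 1) Lc) Lc m) j κ' u κ ((Lc : ℤ) • w + e)
            + sgnK (trK (M2Of 3 L₂ (compMix (ctrOff (3 + 1) Lc) Lc m) j κ' u κ ((Lc : ℤ) • w + e)))))
            (translate M x n) (translate M z' n) (Sum.inl α) (Sum.inl γ) := by
  haveI : ∀ μ, NeZero ((fun i => Lc * M' i) μ) := fun μ => ⟨mul_ne_zero (NeZero.ne Lc) (NeZero.ne (M' μ))⟩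
  rw [tsum_sum_dz_mul_compMixedT2per_even_inl_inl (M' := fun i => Lc * M' i) L₂ j m κ ((Lc : ℤ) • w + e) hVl]
  refine Eq.trans (tsum_congr fun n => ?_) ((Equiv.neg (Site (3 + 1))).tsum_eq _)
  simp only [Equiv.neg_apply, translate_mulPeriod_smul_add,
    tsum_sum_dz_mul_compMixedT2_even_low_copy L₂ j m w n hM (fun w => tdelta M w s) (fun v k => tdelta_translate M v k s)]

omit [NeZero Lc] [∀ μ, NeZero (M' μ)] in
/-- [folklore] **STEP F AT DEPTH `m+1` — THE FOLD**: for any top coefficients `C`, scalar `c₀`, and any family of lower kernels `Row κ e` supported (in each fluctuation site) in the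
depth-(m+1) window `winF (Lc^{m+1}) (wid Lc (m+1)) w` of the coarse bond,
`Σ'_k Σ'_n ( c₀·Σ⁴ C·h·compLin_m((α,x+M∘n);b₁)·compLin_m((γ,z+M∘k+M∘n);b₂) + Σ² ℓ(ρ′,w;b)·Row b (x+M∘n) (z+M∘k+M∘n) )
 = c₀·Σ⁴ C·h·(Σ'_n compLin_m((α,x+M∘n);b₁))·(Σ'_n compLin_m((γ,z+M∘n);b₂)) + Σ² ℓ(ρ′,w;b)·Σ'_k Σ'_n Row b (x+M∘n) (z+M∘k+M∘n)`. -/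
theorem tsum_tsum_storeyWords_succ_eq (C : Site (3 + 1) → Site (3 + 1) → ℝ) (c₀ : ℝ) (Row : Fin (3 + 1) → Site (3 + 1) → Site (3 + 1) → Site (3 + 1) → ℝ)
    (hRowL : ∀ (κ : Fin (3 + 1)) (e : Site (3 + 1)), e ∈ offs Lc → ∀ x' z' : Site (3 + 1), x' ∉ winF (Lc ^ (m + 1)) (wid Lc (m + 1)) w → Row κ e x' z' = 0)
    (hRowR : ∀ (κ : Fin (3 + 1)) (e : Site (3 + 1)), e ∈ offs Lc → ∀ x' z' : Site (3 + 1), z' ∉ winF (Lc ^ (m + 1)) (wid Lc (m + 1)) w → Row κ e x' z' = 0)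
    (x z : Site (3 + 1)) (α γ : Fin (3 + 1)) :
    (∑' k : Site (3 + 1), ∑' n : Site (3 + 1), (c₀ * (∑ κ₁ : Fin (3 + 1), ∑ e₁ ∈ offs Lc, ∑ κ₂ : Fin (3 + 1), ∑ e₂ ∈ offs Lc,
          C e₁ e₂ * symHessKerAt (ctr 4 Lc) Lc ρ' w (κ₁, (Lc : ℤ) • w + e₁) (κ₂, (Lc : ℤ) • w + e₂)
            * compLinKer (fun _ => symLinKerAt (ctr 4 Lc) Lc) Lc m (α, translate M x n) (κ₁, (Lc : ℤ) • w + e₁)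
            * compLinKer (fun _ => symLinKerAt (ctr 4 Lc) Lc) Lc m (γ, translate M (translate M z k) n) (κ₂, (Lc : ℤ) • w + e₂))
        + ∑ κ : Fin (3 + 1), ∑ e ∈ offs Lc, symLinKerAt (ctr 4 Lc) Lc ρ' w (κ, (Lc : ℤ) • w + e) * Row κ e (translate M x n) (translate M (translate M z k) n)))
      = c₀ * (∑ κ₁ : Fin (3 + 1), ∑ e₁ ∈ offs Lc, ∑ κ₂ : Fin (3 + 1), ∑ e₂ ∈ offs Lc,
          C e₁ e₂ * symHessKerAt (ctr 4 Lc) Lc ρ' w (κ₁, (Lc : ℤ) • w + e₁) (κ₂, (Lc : ℤ) • w + e₂)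
            * (∑' n : Site (3 + 1), compLinKer (fun _ => symLinKerAt (ctr 4 Lc) Lc) Lc m (α, translate M x n) (κ₁, (Lc : ℤ) • w + e₁))
            * (∑' n : Site (3 + 1), compLinKer (fun _ => symLinKerAt (ctr 4 Lc) Lc) Lc m (γ, translate M z n) (κ₂, (Lc : ℤ) • w + e₂)))
        + ∑ κ : Fin (3 + 1), ∑ e ∈ offs Lc, symLinKerAt (ctr 4 Lc) Lc ρ' w (κ, (Lc : ℤ) • w + e)
            * ∑' k : Site (3 + 1), ∑' n : Site (3 + 1), Row κ e (translate M x n) (translate M (translate M z k) n) := by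
  -- the fine window of the coarse bond at depth `m+1` and the period indices meeting it
  obtain ⟨Nx, hNx⟩ : ∃ Nx : Finset (Site (3 + 1)), ∀ n ∉ Nx, translate M x n ∉ winF (Lc ^ (m + 1)) (wid Lc (m + 1)) w :=
    ⟨(winF (Lc ^ (m + 1)) (wid Lc (m + 1)) w).preimage (fun n => translate M x n) (translate_injective (M := M) x).injOn, fun n hn h => hn (Finset.mem_preimage.2 h)⟩
  obtain ⟨Nz, hNz⟩ : ∃ Nz : Finset (Site (3 + 1)), ∀ k ∉ Nz, translate M z k ∉ winF (Lc ^ (m + 1)) (wid Lc (m + 1)) w :=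
    ⟨(winF (Lc ^ (m + 1)) (wid Lc (m + 1)) w).preimage (fun k => translate M z k) (translate_injective (M := M) z).injOn, fun k hk h => hk (Finset.mem_preimage.2 h)⟩
  have hℓ0 : ∀ (κ₁ : Fin (3 + 1)) (e₁ : Site (3 + 1)), e₁ ∈ offs Lc → ∀ (ξ : Fin (3 + 1)) (x' : Site (3 + 1)), x' ∉ winF (Lc ^ (m + 1)) (wid Lc (m + 1)) w →
      compLinKer (fun _ => symLinKerAt (ctr 4 Lc) Lc) Lc m (ξ, x') (κ₁, (Lc : ℤ) • w + e₁) = 0 := fun κ₁ e₁ he₁ ξ x' hx' =>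
    compLinKer_eq_zero m (f := (ξ, x')) (g := (κ₁, (Lc : ℤ) • w + e₁)) fun h => hx' (mem_winF_succ_of_offs he₁ h)
  -- the double period sum decouples into a finite double sum
  rw [tsum_tsum_translate_eq_sum_sum M (fun x' z' => c₀ * (∑ κ₁ : Fin (3 + 1), ∑ e₁ ∈ offs Lc, ∑ κ₂ : Fin (3 + 1), ∑ e₂ ∈ offs Lc,
          C e₁ e₂ * symHessKerAt (ctr 4 Lc) Lc ρ' w (κ₁, (Lc : ℤ) • w + e₁) (κ₂, (Lc : ℤ) • w + e₂)
            * compLinKer (fun _ => symLinKerAt (ctr 4 Lc) Lc) Lc m (α, x') (κ₁, (Lc : ℤ) • w + e₁)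
            * compLinKer (fun _ => symLinKerAt (ctr 4 Lc) Lc) Lc m (γ, z') (κ₂, (Lc : ℤ) • w + e₂))
        + ∑ κ : Fin (3 + 1), ∑ e ∈ offs Lc, symLinKerAt (ctr 4 Lc) Lc ρ' w (κ, (Lc : ℤ) • w + e) * Row κ e x' z') x z Nx Nz
      (fun n hn z' => by
        rw [Finset.sum_eq_zero fun κ₁ _ => Finset.sum_eq_zero fun e₁ he₁ => Finset.sum_eq_zero fun κ₂ _ => Finset.sum_eq_zero fun e₂ _ => by
            rw [hℓ0 κ₁ e₁ he₁ α _ (hNx n hn), mul_zero, zero_mul],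
          Finset.sum_eq_zero fun κ _ => Finset.sum_eq_zero fun e he => by rw [hRowL κ e he _ _ (hNx n hn), mul_zero], mul_zero, add_zero])
      (fun k hk x' => by
        rw [Finset.sum_eq_zero fun κ₁ _ => Finset.sum_eq_zero fun e₁ _ => Finset.sum_eq_zero fun κ₂ _ => Finset.sum_eq_zero fun e₂ he₂ => by
            rw [hℓ0 κ₂ e₂ he₂ γ _ (hNz k hk), mul_zero],
          Finset.sum_eq_zero fun κ _ => Finset.sum_eq_zero fun e he => by rw [hRowR κ e he _ _ (hNz k hk), mul_zero], mul_zero, add_zero])]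
  have hℓx : ∀ (κ₁ : Fin (3 + 1)) (e₁ : Site (3 + 1)), e₁ ∈ offs Lc →
      (∑' n : Site (3 + 1), compLinKer (fun _ => symLinKerAt (ctr 4 Lc) Lc) Lc m (α, translate M x n) (κ₁, (Lc : ℤ) • w + e₁))
        = ∑ n ∈ Nx, compLinKer (fun _ => symLinKerAt (ctr 4 Lc) Lc) Lc m (α, translate M x n) (κ₁, (Lc : ℤ) • w + e₁) := fun κ₁ e₁ he₁ =>
    tsum_eq_sum fun n hn => hℓ0 κ₁ e₁ he₁ α _ (hNx n hn)
  have hℓz : ∀ (κ₂ : Fin (3 + 1)) (e₂ : Site (3 + 1)), e₂ ∈ offs Lc →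
      (∑' n : Site (3 + 1), compLinKer (fun _ => symLinKerAt (ctr 4 Lc) Lc) Lc m (γ, translate M z n) (κ₂, (Lc : ℤ) • w + e₂))
        = ∑ k ∈ Nz, compLinKer (fun _ => symLinKerAt (ctr 4 Lc) Lc) Lc m (γ, translate M z k) (κ₂, (Lc : ℤ) • w + e₂) := fun κ₂ e₂ he₂ =>
    tsum_eq_sum fun k hk => hℓ0 κ₂ e₂ he₂ γ _ (hNz k hk)
  have hR : ∀ (κ : Fin (3 + 1)) (e : Site (3 + 1)), e ∈ offs Lc →
      (∑' k : Site (3 + 1), ∑' n : Site (3 + 1), Row κ e (translate M x n) (translate M (translate M z k) n))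
        = ∑ n ∈ Nx, ∑ k ∈ Nz, Row κ e (translate M x n) (translate M z k) := fun κ e he =>
    tsum_tsum_translate_eq_sum_sum M (Row κ e) x z Nx Nz (fun n hn z' => hRowL κ e he _ _ (hNx n hn)) (fun k hk x' => hRowR κ e he _ _ (hNz k hk))
  -- fold each storey back
  have eTop : (∑ n ∈ Nx, ∑ k ∈ Nz, ∑ κ₁ : Fin (3 + 1), ∑ e₁ ∈ offs Lc, ∑ κ₂ : Fin (3 + 1), ∑ e₂ ∈ offs Lc,
          C e₁ e₂ * symHessKerAt (ctr 4 Lc) Lc ρ' w (κ₁, (Lc : ℤ) • w + e₁) (κ₂, (Lc : ℤ) • w + e₂)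
            * compLinKer (fun _ => symLinKerAt (ctr 4 Lc) Lc) Lc m (α, translate M x n) (κ₁, (Lc : ℤ) • w + e₁)
            * compLinKer (fun _ => symLinKerAt (ctr 4 Lc) Lc) Lc m (γ, translate M z k) (κ₂, (Lc : ℤ) • w + e₂))
      = ∑ κ₁ : Fin (3 + 1), ∑ e₁ ∈ offs Lc, ∑ κ₂ : Fin (3 + 1), ∑ e₂ ∈ offs Lc,
          C e₁ e₂ * symHessKerAt (ctr 4 Lc) Lc ρ' w (κ₁, (Lc : ℤ) • w + e₁) (κ₂, (Lc : ℤ) • w + e₂)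
            * (∑' n : Site (3 + 1), compLinKer (fun _ => symLinKerAt (ctr 4 Lc) Lc) Lc m (α, translate M x n) (κ₁, (Lc : ℤ) • w + e₁))
            * (∑' n : Site (3 + 1), compLinKer (fun _ => symLinKerAt (ctr 4 Lc) Lc) Lc m (γ, translate M z n) (κ₂, (Lc : ℤ) • w + e₂)) := by
    rw [Finset.sum_congr rfl fun n _ => sum_push4 Nz _, sum_push4 Nx]
    refine Finset.sum_congr rfl fun κ₁ _ => Finset.sum_congr rfl fun e₁ he₁ => Finset.sum_congr rfl fun κ₂ _ => Finset.sum_congr rfl fun e₂ he₂ => ?_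
    rw [hℓx κ₁ e₁ he₁, hℓz κ₂ e₂ he₂, mul_assoc _ (∑ n ∈ Nx, _) (∑ k ∈ Nz, _), Finset.sum_mul_sum, Finset.mul_sum]
    refine Finset.sum_congr rfl fun n _ => ?_
    rw [Finset.mul_sum]
    exact Finset.sum_congr rfl fun k _ => by ring
  have eLow : (∑ n ∈ Nx, ∑ k ∈ Nz, ∑ κ : Fin (3 + 1), ∑ e ∈ offs Lc, symLinKerAt (ctr 4 Lc) Lc ρ' w (κ, (Lc : ℤ) • w + e) * Row κ e (translate M x n) (translate M z k))
      = ∑ κ : Fin (3 + 1), ∑ e ∈ offs Lc, symLinKerAt (ctr 4 Lc) Lc ρ' w (κ, (Lc : ℤ) • w + e)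
          * ∑' k : Site (3 + 1), ∑' n : Site (3 + 1), Row κ e (translate M x n) (translate M (translate M z k) n) := by
    rw [Finset.sum_congr rfl fun n _ => sum_push2 Nz _, sum_push2 Nx]
    refine Finset.sum_congr rfl fun κ _ => Finset.sum_congr rfl fun e he => ?_
    rw [hR κ e he, Finset.mul_sum]
    exact Finset.sum_congr rfl fun n _ => by rw [Finset.mul_sum]
  rw [← eTop, ← eLow]
  simp only [Finset.sum_add_distrib, Finset.mul_sum]

/-- [folklore] **`sum_tgrad_mul_perZ_dper_compMixedT2per_even_succ` — (K2b) ON THE TORUS AT DEPTH `m+1`, STOREYWISE, ENTRYWISE, ANY BOX `M = Lc^{m+1}·M′`**: the row of the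
coarse-slot-periodised even composite mixed table of depth `m+1` along the indicator gauge `δ_s` is
`wM2 · Σ_{b₁,b₂ ∈ win β} (δ_s(R_m b₂) − δ_s(R_m b₁))·h(β;b₁,b₂)·cL̃_m((α,x);b₁)·cL̃_m((γ,z);b₂) + Σ_{b ∈ win β} ℓ(β;b)·[the row of the periodised depth-m table at b]`,
`cL̃_m((α,x);b) := Σ'_n compLin_m((α, x+M∘n); b)` (the fine-slot-periodised `m`-fold transport), the depth-`m` family at `b = (κ, Lc•w+e)` periodised in its coarse slot over the
level-`m` period lattice `Lc·M′` (`hVl`): PART 32's recursion, periodised.  At `m = 1` the lower rows are PART 26's (pure commutators) and the display is PART 31c's. -/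
theorem sum_tgrad_mul_perZ_dper_compMixedT2per_even_succ (hM : ∀ i, M i = Lc ^ (m + 1) * M' i)
    (hV : V = fun κ u x z a c => ∑' n : Site (3 + 1),
      ((1 / 2 : ℝ) • (M2Of 3 L₂ (compMix (ctrOff (3 + 1) Lc) Lc (m + 1)) j κ u ρ' (translate M' w n)
          + sgnK (trK (M2Of 3 L₂ (compMix (ctrOff (3 + 1) Lc) Lc (m + 1)) j κ u ρ' (translate M' w n))))) x z a c)
    (hVl : ∀ (κ : Fin (3 + 1)) (e : Site (3 + 1)), Vl κ e = fun κ' u x z a c => ∑' n : Site (3 + 1),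
      ((1 / 2 : ℝ) • (M2Of 3 L₂ (compMix (ctrOff (3 + 1) Lc) Lc m) j κ' u κ (translate (fun i => Lc * M' i) ((Lc : ℤ) • w + e) n)
          + sgnK (trK (M2Of 3 L₂ (compMix (ctrOff (3 + 1) Lc) Lc m) j κ' u κ (translate (fun i => Lc * M' i) ((Lc : ℤ) • w + e) n))))) x z a c)
    (s : ↥(pbox M)) (x z : Site (3 + 1)) (α γ : Fin (3 + 1)) :
    ∑ u : ↥(pbox M), ∑ κ : Fin (3 + 1), tgrad M (u, Sum.inl κ) s * perZ M (dper M (V κ (u : Site (3 + 1)))) x z (Sum.inl α) (Sum.inl γ)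
      = wM2 3 L₂ j * (∑ κ₁ : Fin (3 + 1), ∑ e₁ ∈ offs Lc, ∑ κ₂ : Fin (3 + 1), ∑ e₂ ∈ offs Lc,
          (tdelta M (((Lc ^ m : ℕ) : ℤ) • ((Lc : ℤ) • w + e₂) + ∑ k ∈ Finset.range m, ((Lc ^ k : ℕ) : ℤ) • ctr 4 Lc) s
              - tdelta M (((Lc ^ m : ℕ) : ℤ) • ((Lc : ℤ) • w + e₁) + ∑ k ∈ Finset.range m, ((Lc ^ k : ℕ) : ℤ) • ctr 4 Lc) s)
            * symHessKerAt (ctr 4 Lc) Lc ρ' w (κ₁, (Lc : ℤ) • w + e₁) (κ₂, (Lc : ℤ) • w + e₂)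
            * (∑' n : Site (3 + 1), compLinKer (fun _ => symLinKerAt (ctr 4 Lc) Lc) Lc m (α, translate M x n) (κ₁, (Lc : ℤ) • w + e₁))
            * (∑' n : Site (3 + 1), compLinKer (fun _ => symLinKerAt (ctr 4 Lc) Lc) Lc m (γ, translate M z n) (κ₂, (Lc : ℤ) • w + e₂)))
        + ∑ κ : Fin (3 + 1), ∑ e ∈ offs Lc, symLinKerAt (ctr 4 Lc) Lc ρ' w (κ, (Lc : ℤ) • w + e)
            * ∑ u : ↥(pbox M), ∑ κ' : Fin (3 + 1), tgrad M (u, Sum.inl κ') s * perZ M (dper M (Vl κ e κ' (u : Site (3 + 1)))) x z (Sum.inl α) (Sum.inl γ) := by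
  haveI : ∀ μ, NeZero ((fun i => Lc * M' i) μ) := fun μ => ⟨mul_ne_zero (NeZero.ne Lc) (NeZero.ne (M' μ))⟩
  have hM' : ∀ i, M i = Lc ^ m * (fun i => Lc * M' i) i := fun i => by rw [hM i, pow_succ]; ring
  -- Step A for the depth-(m+1) family and for each lower family
  rw [sum_tgrad_mul_perZ_dper_eq_tsum_of_periodCov V
      (fun x => (Fintype.piFinset fun _ : Fin (3 + 1) => Finset.Icc (-(wid Lc (m + 1) : ℤ)) (wid Lc (m + 1) : ℤ)).image (fun v => x - v))
      (fun x => (Fintype.piFinset fun _ : Fin (3 + 1) => Finset.Icc (-(wid Lc (m + 1) : ℤ)) (wid Lc (m + 1) : ℤ)).image (fun v => x - v))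
      (Sum.inl α) (Sum.inl γ) (compMixedT2per_even_periodCov L₂ j (m + 1) ρ' w hM hV)
      (fun κ u x => compMixedT2per_even_inl_inl_eq_zero_of_not_mem_S L₂ j (m + 1) ρ' w hV κ u x α γ)
      (fun κ x z => compMixedT2per_even_inl_inl_eq_zero_of_not_mem_T L₂ j (m + 1) ρ' w hV κ x z α γ) s x z,
    tsum_congr fun k => tsum_sum_dz_tdelta_mul_compMixedT2per_even_succ L₂ j m ρ' w hM hV s x (translate M z k) α γ]
  have hlowA : ∀ (κ : Fin (3 + 1)) (e : Site (3 + 1)),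
      (∑ u : ↥(pbox M), ∑ κ' : Fin (3 + 1), tgrad M (u, Sum.inl κ') s * perZ M (dper M (Vl κ e κ' (u : Site (3 + 1)))) x z (Sum.inl α) (Sum.inl γ))
        = ∑' k : Site (3 + 1), ∑' n : Site (3 + 1), ∑' u : Site (3 + 1), ∑ κ' : Fin (3 + 1), dz (fun w => tdelta M w s) κ' u *
          ((1 / 2 : ℝ) • (M2Of 3 L₂ (compMix (ctrOff (3 + 1) Lc) Lc m) j κ' u κ ((Lc : ℤ) • w + e)
            + sgnK (trK (M2Of 3 L₂ (compMix (ctrOff (3 + 1) Lc) Lc m) j κ' u κ ((Lc : ℤ) • w + e)))))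
            (translate M x n) (translate M (translate M z k) n) (Sum.inl α) (Sum.inl γ) := fun κ e => by
    rw [sum_tgrad_mul_perZ_dper_eq_tsum_of_periodCov (Vl κ e)
      (fun x => (Fintype.piFinset fun _ : Fin (3 + 1) => Finset.Icc (-(wid Lc m : ℤ)) (wid Lc m : ℤ)).image (fun v => x - v))
      (fun x => (Fintype.piFinset fun _ : Fin (3 + 1) => Finset.Icc (-(wid Lc m : ℤ)) (wid Lc m : ℤ)).image (fun v => x - v))
      (Sum.inl α) (Sum.inl γ) (compMixedT2per_even_periodCov L₂ j m κ ((Lc : ℤ) • w + e) hM' (hVl κ e))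
      (fun κ' u x => compMixedT2per_even_inl_inl_eq_zero_of_not_mem_S L₂ j m κ ((Lc : ℤ) • w + e) (hVl κ e) κ' u x α γ)
      (fun κ' x z => compMixedT2per_even_inl_inl_eq_zero_of_not_mem_T L₂ j m κ ((Lc : ℤ) • w + e) (hVl κ e) κ' x z α γ) s x z]
    exact tsum_congr fun k => tsum_sum_dz_tdelta_mul_compMixedT2per_even_low L₂ j m w hM κ e (hVl κ e) s x (translate M z k) α γ
  simp only [hlowA]
  -- Step F: the fold, with the lower kernels = the lattice rows of the depth-`m` tables (supported in the depth-(m+1) window of the coarse bond in each fluctuation site)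
  refine tsum_tsum_storeyWords_succ_eq m ρ' w
    (fun e₁ e₂ => tdelta M (((Lc ^ m : ℕ) : ℤ) • ((Lc : ℤ) • w + e₂) + ∑ k ∈ Finset.range m, ((Lc ^ k : ℕ) : ℤ) • ctr 4 Lc) s
      - tdelta M (((Lc ^ m : ℕ) : ℤ) • ((Lc : ℤ) • w + e₁) + ∑ k ∈ Finset.range m, ((Lc ^ k : ℕ) : ℤ) • ctr 4 Lc) s)
    (wM2 3 L₂ j)
    (fun κ e x' z' => ∑' u : Site (3 + 1), ∑ κ' : Fin (3 + 1), dz (fun w => tdelta M w s) κ' u *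
      ((1 / 2 : ℝ) • (M2Of 3 L₂ (compMix (ctrOff (3 + 1) Lc) Lc m) j κ' u κ ((Lc : ℤ) • w + e)
        + sgnK (trK (M2Of 3 L₂ (compMix (ctrOff (3 + 1) Lc) Lc m) j κ' u κ ((Lc : ℤ) • w + e))))) x' z' (Sum.inl α) (Sum.inl γ))
    (fun κ e he x' z' hx' => ?_) (fun κ e he x' z' hz' => ?_) x z α γ
  · refine (tsum_congr fun u => Finset.sum_eq_zero fun κ' _ => ?_).trans tsum_zero
    rw [compMixedT2_even_inl_inl_eq_zero_of_left L₂ j m κ' u κ _ (fun h => hx' (mem_winF_succ_of_offs he h)) z' α γ, mul_zero]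
  · refine (tsum_congr fun u => Finset.sum_eq_zero fun κ' _ => ?_).trans tsum_zero
    rw [compMixedT2_even_inl_inl_eq_zero_of_right L₂ j m κ' u κ _ x' (fun h => hz' (mem_winF_succ_of_offs he h)) α γ, mul_zero]

end Torus

end Summit.QuantumFields.BalabanUV.Beta.CombMixedT2EvenStoreyTorus

end
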